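import Mathlib
import HarnessLib

/-!
# Cube roots modulo a prime: roots of unity, the case `p ≡ 2 (mod 3)`, generators, the `3`-free part

Elementary facts behind the computation of cube roots in the prime field `ZMod p`
(Adleman–Manders–Miller 1977; Cohen, *A Course in Computational Algebraic Number Theory*, §1.5):

* `pow_three_eq_one_iff` — if `ζ³ = 1 ≠ ζ` then the cube roots of unity are exactly `1, ζ, ζ²`;
  `pow_three_eq_iff` — all cube roots of `m ≠ 0` from one: `r, rζ, rζ²`;
* `pow_three_pow_two_mul_sub_one_div_three` — for `p ≡ 2 (mod 3)` the residue `m^{(2p-1)/3}` is a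
  cube root of `m`, and `pow_three_injective` — cubing is injective when `3 ∤ p - 1`;
* `pow_div_three_eq_one_of_pow_three_eq` — Euler's criterion for cubes, necessary direction;
* `iterate_div_three_spec`, `not_dvd_iterate_div_three` — the loop `s ↦ (3 ∣ s ? s/3 : s)` run
  `N` times from `s₀ < 2^N` reaches the `3`-free part of `s₀` (the decomposition `p - 1 = 3ᵏ·s`
  of the Adleman–Manders–Miller / Tonelli–Shanks algorithm, computed by a bounded loop).

The iteration itself (one cube root for `p ≡ 1 (mod 3)` from a cubic non-residue) is in
`CubeRootsAMM.lean` (independent of this file). Theorem-only file; no definitions.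

## References

* L. M. Adleman, K. L. Manders, G. L. Miller, *On taking roots in finite fields*, FOCS 1977
  [AdlemanMandersMiller1977].
* H. Cohen, *A Course in Computational Algebraic Number Theory*, GTM 138, Springer 1993, §1.5
  [Cohen1993].
-/

namespace Literature.NumberTheory.ModularRoots

/-! ### Cube roots of unity and of a non-zero element in a field -/

section Field

variable {F : Type*} [Field F]

/-- A cube root of unity `ζ ≠ 1` of a field satisfies `ζ² + ζ + 1 = 0`. [folklore] -/
theorem sq_add_self_add_one_eq_zero {ζ : F} (h3 : ζ ^ 3 = 1) (h1 : ζ ≠ 1) : ζ ^ 2 + ζ + 1 = 0 := by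
  have h : (ζ - 1) * (ζ ^ 2 + ζ + 1) = 0 := by linear_combination h3
  rcases mul_eq_zero.1 h with h | h
  · exact absurd (sub_eq_zero.1 h) h1
  · exact h

/-- **The cube roots of unity of a field containing `ζ` with `ζ³ = 1 ≠ ζ` are exactly `1, ζ, ζ²`.**
[folklore] -/
theorem pow_three_eq_one_iff {ζ : F} (h3 : ζ ^ 3 = 1) (h1 : ζ ≠ 1) (w : F) :
    w ^ 3 = 1 ↔ w = 1 ∨ w = ζ ∨ w = ζ ^ 2 := by
  have hζ := sq_add_self_add_one_eq_zero h3 h1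
  constructor
  · intro hw
    by_cases hw1 : w = 1
    · exact Or.inl hw1
    have hw' := sq_add_self_add_one_eq_zero hw hw1
    have h : (w - ζ) * (w - ζ ^ 2) = 0 := by linear_combination hw' - w * hζ + h3
    rcases mul_eq_zero.1 h with h | h
    · exact Or.inr (Or.inl (sub_eq_zero.1 h))
    · exact Or.inr (Or.inr (sub_eq_zero.1 h))
  · rintro (rfl | rfl | rfl)
    · exact one_pow 3
    · exact h3
    · rw [← pow_mul, show 2 * 3 = 3 * 2 from rfl, pow_mul, h3, one_pow]

/-- **All cube roots of `m ≠ 0` from one of them**: if `r³ = m` then `w³ = m ↔ w ∈ {r, rζ, rζ²}`.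
[folklore] -/
theorem pow_three_eq_iff {ζ : F} (h3 : ζ ^ 3 = 1) (h1 : ζ ≠ 1) {r m : F} (hr : r ^ 3 = m)
    (hm : m ≠ 0) (w : F) : w ^ 3 = m ↔ w = r ∨ w = r * ζ ∨ w = r * ζ ^ 2 := by
  have hr0 : r ≠ 0 := by
    rintro rfl
    exact hm (by rw [← hr]; ring)
  have key : w ^ 3 = m ↔ (w / r) ^ 3 = 1 := by
    rw [div_pow, hr, div_eq_one_iff_eq hm]
  rw [key, pow_three_eq_one_iff h3 h1, div_eq_iff hr0, div_eq_iff hr0, div_eq_iff hr0, one_mul,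
    mul_comm ζ r, mul_comm (ζ ^ 2) r]

end Field

/-! ### The prime field: `p ≡ 2 (mod 3)`, Euler's criterion -/

section Prime

variable {p : ℕ} [hp : Fact p.Prime]

/-- **Cube roots for `p ≡ 2 (mod 3)`**: `(m^{(2p-1)/3})³ = m` in `ZMod p` (Fermat: `3·(2p-1)/3 =
2(p-1) + 1`). [cite: Cohen1993, §1.5] -/
theorem pow_three_pow_two_mul_sub_one_div_three (h2 : p % 3 = 2) (m : ZMod p) :
    (m ^ ((2 * p - 1) / 3)) ^ 3 = m := by
  have hp2 : 2 ≤ p := hp.out.two_le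
  have h3 : 3 * ((2 * p - 1) / 3) = 2 * p - 1 := Nat.mul_div_cancel' (Nat.dvd_of_mod_eq_zero (by omega))
  rw [← pow_mul, mul_comm, h3]
  by_cases hm : m = 0
  · rw [hm, zero_pow (by omega)]
  · rw [show 2 * p - 1 = (p - 1) * 2 + 1 by omega, pow_succ, pow_mul, ZMod.pow_card_sub_one_eq_one hm,
      one_pow, one_mul]

/-- **Cubing is injective on `ZMod p` when `3 ∤ p - 1`** (`u³ = 1 = u^{p-1}` and `gcd(3, p-1) = 1`
force `u = 1`). [folklore] -/
theorem pow_three_injective (h3 : ¬ 3 ∣ p - 1) {w r : ZMod p} (h : w ^ 3 = r ^ 3) : w = r := by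
  by_cases hr : r = 0
  · rw [hr] at h ⊢
    exact (pow_eq_zero_iff (n := 3) (by norm_num)).1 (by rw [h]; ring)
  have hw : w ≠ 0 := by
    rintro rfl
    exact hr ((pow_eq_zero_iff (n := 3) (by norm_num)).1 (by rw [← h]; ring))
  have hu3 : (w / r) ^ 3 = 1 := by rw [div_pow, h, div_self (pow_ne_zero 3 hr)]
  have hup : (w / r) ^ (p - 1) = 1 := ZMod.pow_card_sub_one_eq_one (div_ne_zero hw hr)
  have hcop : Nat.Coprime 3 (p - 1) := (Nat.Prime.coprime_iff_not_dvd Nat.prime_three).2 h3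
  have h1 : w / r = 1 := (pow_eq_one_iff_of_coprime hcop).1 ⟨hu3, hup⟩
  exact (div_eq_one_iff_eq hr).1 h1

/-- **Euler's criterion for cubes, necessary direction**: a non-zero cube `m = r³` with `3 ∣ p - 1`
has `m^{(p-1)/3} = r^{p-1} = 1`. [cite: Cohen1993, §1.5] -/
theorem pow_div_three_eq_one_of_pow_three_eq {r m : ZMod p} (hr : r ^ 3 = m) (hm : m ≠ 0)
    (h3 : 3 ∣ p - 1) : m ^ ((p - 1) / 3) = 1 := by
  have hr0 : r ≠ 0 := by
    rintro rfl
    exact hm (by rw [← hr]; ring)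
  rw [← hr, ← pow_mul, Nat.mul_div_cancel' h3, ZMod.pow_card_sub_one_eq_one hr0]

end Prime

/-! ### The `3`-free part of `p - 1` by a bounded loop -/

/-- **Removing the factors `3`**: after `n` rounds of `s ↦ (3 ∣ s ? s/3 : s)` from `s₀` the value
`s` satisfies `s · 3ʲ = s₀` for some `j ≤ n`, and `j = n` as long as `3` still divides `s`.
[cite: AdlemanMandersMiller1977, §2] -/
theorem iterate_div_three_spec (H : ℕ → ℕ) (hH : ∀ s, H s = if s % 3 = 0 then s / 3 else s)
    (s₀ : ℕ) : ∀ n : ℕ, ∃ j ≤ n, H^[n] s₀ * 3 ^ j = s₀ ∧ (H^[n] s₀ % 3 = 0 → j = n) := by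
  intro n
  induction n with
  | zero => exact ⟨0, le_rfl, by simp, fun _ => rfl⟩
  | succ n ih =>
    obtain ⟨j, hj, hval, hdiv⟩ := ih
    rw [Function.iterate_succ_apply', hH]
    split_ifs with h
    · refine ⟨j + 1, by omega, ?_, fun _ => by rw [hdiv h]⟩
      rw [pow_succ', ← mul_assoc, Nat.div_mul_cancel (Nat.dvd_of_mod_eq_zero h)]
      exact hval
    · exact ⟨j, by omega, hval, fun h' => absurd h' h⟩

/-- **The loop reaches the `3`-free part**: if `0 < s₀ < 2^N` then after `N` rounds `3 ∤ s` and
`s · 3ᵏ = s₀` for some `k ≤ N`. [cite: AdlemanMandersMiller1977, §2] -/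
theorem not_dvd_iterate_div_three (H : ℕ → ℕ) (hH : ∀ s, H s = if s % 3 = 0 then s / 3 else s)
    {s₀ N : ℕ} (h0 : 0 < s₀) (hN : s₀ < 2 ^ N) :
    ¬ 3 ∣ H^[N] s₀ ∧ ∃ k ≤ N, H^[N] s₀ * 3 ^ k = s₀ := by
  obtain ⟨j, hj, hval, hdiv⟩ := iterate_div_three_spec H hH s₀ N
  refine ⟨fun h3 => ?_, j, hj, hval⟩
  have hjN : j = N := hdiv (Nat.mod_eq_zero_of_dvd h3)
  subst hjN
  have hs : 1 ≤ H^[j] s₀ := by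
    rcases Nat.eq_zero_or_pos (H^[j] s₀) with h | h
    · rw [h, zero_mul] at hval; omega
    · exact h
  have h3j : 3 ^ j ≤ s₀ := by
    calc 3 ^ j = 1 * 3 ^ j := (one_mul _).symm
      _ ≤ H^[j] s₀ * 3 ^ j := Nat.mul_le_mul_right _ hs
      _ = s₀ := hval
  have h23 : 2 ^ j ≤ 3 ^ j := Nat.pow_le_pow_left (by norm_num) j
  omega

end Literature.NumberTheory.ModularRoots
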